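import Literature.Analysis.FluidPDE.PassiveScalarDiagMild
import HarnessLib

/-!
# Mild (Duhamel) formulation of the passive scalar equation with constant diagonal diffusion and
  bounded drift, V: finite `ℓ²` norms and admissible coefficient families

Analysis/FluidPDE proof-support file (everything proved), sequel of `PassiveScalarDiagMild`. The space
in which the Picard iteration of the mild equation runs: coefficient families `c : [0,T] × ℤ^d → ℂ`
continuous in time at each frequency, with finite `ℓ²` norms `l2F F (c t) = (∑_{k∈F} ‖c t k‖²)^{1/2}`
bounded by `B`, and conjugate symmetric (`Torus.IsMildCoeff`). Minkowski for the finite norms; the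
**synthesis** of such a family by a jointly measurable real field with `𝓕(w(t)) = c(t)` and
`∫ w(t)² ≤ B²` for EVERY `t ∈ [0,T]` (the tree's parametrised Riesz–Fischer theorem
`Torus.exists_realScalarField_forall_mFourierCoeff_eq`); Parseval for differences of synthesized
fields. Also the data record `Torus.MildData` of the Picard iteration (horizon, diffusivity, damping
rate, drift bound, coefficients, drift, datum, and the contraction hypothesis) with `A = ‖θ₀‖_{L²}`,
`B = 2A`.

## References

* A. Pazy, *Semigroups of Linear Operators and Applications to PDE*, Springer 1983, Ch. 4 §4.2
  (mild solutions, (2.3), Def. 2.3), Ch. 6 §6.1 Thm. 1.2 (Picard iteration for the mild equation).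
* R. J. DiPerna, P.-L. Lions, Invent. Math. 98 (1989) 511–547, §II.1. L. C. Evans, *PDE* (2010), §7.1.2.
* L. Grafakos, *Classical Fourier Analysis*, 3rd ed. (2014), Prop. 3.2.6 (4), (8), Prop. 3.2.7 (3), §3.3.1.
* J. C. Robinson, J. L. Rodrigo, W. Sadowski, *The Three-Dimensional Navier–Stokes Equations* (2016), Thm. 4.11.
-/

noncomputable section

open MeasureTheory TopologicalSpace Set Function Filter UnitAddTorus
open _root_.Topology
open scoped ENNReal NNReal InnerProductSpace ComplexConjugate

namespace Literature.Analysis.FluidPDE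

namespace Torus

open Literature.Analysis.FunctionSpaces.Torus Literature.Analysis.FunctionSpaces

variable {d : Type*} [Fintype d]

/-! ## Finite `ℓ²` norms of coefficient families -/

section L2F

omit [Fintype d]

/-- The `ℓ²` norm of a coefficient family over a finite frequency set, `(∑_{k∈F} ‖x k‖²)^{1/2}`. [folklore] -/
def l2F (F : Finset (d → ℤ)) (x : (d → ℤ) → ℂ) : ℝ := Real.sqrt (∑ k ∈ F, ‖x k‖ ^ 2)

/-- Unfolding `l2F`. [cite: Grafakos2014, Prop. 3.2.7 (3)] -/
theorem l2F_apply (F : Finset (d → ℤ)) (x : (d → ℤ) → ℂ) : l2F F x = Real.sqrt (∑ k ∈ F, ‖x k‖ ^ 2) := rfl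

/-- `l2F ≥ 0`. [cite: Grafakos2014, Prop. 3.2.7 (3)] -/
theorem l2F_nonneg (F : Finset (d → ℤ)) (x : (d → ℤ) → ℂ) : 0 ≤ l2F F x := Real.sqrt_nonneg _

/-- `(l2F F x)² = ∑_{k∈F} ‖x k‖²`. [cite: Grafakos2014, Prop. 3.2.7 (3)] -/
theorem l2F_sq (F : Finset (d → ℤ)) (x : (d → ℤ) → ℂ) : l2F F x ^ 2 = ∑ k ∈ F, ‖x k‖ ^ 2 :=
  Real.sq_sqrt (Finset.sum_nonneg fun _ _ => sq_nonneg _)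

/-- `l2F F x ≤ B` iff `∑_{k∈F} ‖x k‖² ≤ B²` (`B ≥ 0`). [cite: Grafakos2014, Prop. 3.2.7 (3)] -/
theorem l2F_le_iff {F : Finset (d → ℤ)} {x : (d → ℤ) → ℂ} {B : ℝ} (hB : 0 ≤ B) :
    l2F F x ≤ B ↔ ∑ k ∈ F, ‖x k‖ ^ 2 ≤ B ^ 2 := by
  rw [l2F_apply, Real.sqrt_le_left hB]

/-- A single coordinate is bounded by the finite `ℓ²` norm of any set containing it. [cite: Grafakos2014, Prop. 3.2.7 (3)] -/
theorem norm_le_l2F {F : Finset (d → ℤ)} {k : d → ℤ} (hk : k ∈ F) (x : (d → ℤ) → ℂ) : ‖x k‖ ≤ l2F F x := by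
  rw [l2F_apply]
  refine Real.le_sqrt_of_sq_le ?_
  exact Finset.single_le_sum (f := fun k => ‖x k‖ ^ 2) (fun _ _ => sq_nonneg _) hk

/-- **Minkowski for finite `ℓ²` sums**: `l2F F (x + y) ≤ l2F F x + l2F F y`. [cite: Grafakos2014, Prop. 3.2.7 (3)] -/
theorem l2F_add_le (F : Finset (d → ℤ)) (x y : (d → ℤ) → ℂ) :
    l2F F (fun k => x k + y k) ≤ l2F F x + l2F F y := by
  have hX := l2F_nonneg F x
  have hY := l2F_nonneg F y
  rw [← pow_le_pow_iff_left₀ (l2F_nonneg F _) (add_nonneg hX hY) two_ne_zero, l2F_sq, add_sq, l2F_sq, l2F_sq]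
  -- Cauchy–Schwarz for the cross term
  have hcs : ∑ k ∈ F, ‖x k‖ * ‖y k‖ ≤ l2F F x * l2F F y := by
    have h := Finset.sum_mul_sq_le_sq_mul_sq F (fun k => ‖x k‖) (fun k => ‖y k‖)
    rw [← l2F_sq, ← l2F_sq, ← mul_pow] at h
    exact abs_le_of_sq_le_sq' h (mul_nonneg hX hY) |>.2
  calc ∑ k ∈ F, ‖x k + y k‖ ^ 2 ≤ ∑ k ∈ F, (‖x k‖ + ‖y k‖) ^ 2 :=
        Finset.sum_le_sum fun k _ => pow_le_pow_left₀ (norm_nonneg _) (norm_add_le _ _) 2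
    _ = ∑ k ∈ F, ‖x k‖ ^ 2 + 2 * ∑ k ∈ F, ‖x k‖ * ‖y k‖ + ∑ k ∈ F, ‖y k‖ ^ 2 := by
        rw [Finset.mul_sum, ← Finset.sum_add_distrib, ← Finset.sum_add_distrib]
        exact Finset.sum_congr rfl fun k _ => by ring
    _ ≤ ∑ k ∈ F, ‖x k‖ ^ 2 + 2 * l2F F x * l2F F y + ∑ k ∈ F, ‖y k‖ ^ 2 := by linarith

/-- Minkowski, subtractive form: `l2F F (x - y) ≤ l2F F x + l2F F y`. [cite: Grafakos2014, Prop. 3.2.7 (3)] -/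
theorem l2F_sub_le (F : Finset (d → ℤ)) (x y : (d → ℤ) → ℂ) :
    l2F F (fun k => x k - y k) ≤ l2F F x + l2F F y := by
  have h := l2F_add_le F x (fun k => -y k)
  have e : l2F F (fun k => -y k) = l2F F y := by simp only [l2F_apply, norm_neg]
  simpa only [sub_eq_add_neg, e] using h

/-- The finite `ℓ²` norm is symmetric under `x ↦ -x`-type sign changes of differences. [cite: Grafakos2014, Prop. 3.2.7 (3)] -/
theorem l2F_sub_comm (F : Finset (d → ℤ)) (x y : (d → ℤ) → ℂ) :
    l2F F (fun k => x k - y k) = l2F F (fun k => y k - x k) := by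
  simp only [l2F_apply, norm_sub_rev]

/-- Triangle inequality through an intermediate family. [cite: Grafakos2014, Prop. 3.2.7 (3)] -/
theorem l2F_sub_le_of_le {F : Finset (d → ℤ)} {x y z : (d → ℤ) → ℂ} {A B : ℝ}
    (h₁ : l2F F (fun k => x k - y k) ≤ A) (h₂ : l2F F (fun k => y k - z k) ≤ B) :
    l2F F (fun k => x k - z k) ≤ A + B := by
  have h := l2F_add_le F (fun k => x k - y k) (fun k => y k - z k)
  have e : (fun k => x k - y k + (y k - z k)) = fun k => x k - z k := by funext k; ring
  rw [e] at h
  exact h.trans (add_le_add h₁ h₂)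

end L2F

/-! ## Admissible coefficient families and their synthesized fields -/

section Coeff

variable [DecidableEq d] [Nonempty d]
variable {T B : ℝ} {c c' : ℝ → (d → ℤ) → ℂ}

/-- **Admissible coefficient families on `[0,T]`** (the space in which the Picard iteration runs):
every coordinate `t ↦ c(t)(k)` is continuous on `[0,T]`, the finite `ℓ²` norms are bounded by `B`,
and the reality condition `c(t)(-k) = conj (c(t)(k))` holds — exactly the hypotheses of the
parametrised Riesz–Fischer synthesis `Torus.exists_realScalarField_forall_mFourierCoeff_eq`
(Robinson–Rodrigo–Sadowski 2016, proof of Thm. 4.11: "define `u(t)` by its Fourier coefficients").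
[cite: RobinsonRodrigoSadowski2016, Thm. 4.11] -/
structure IsMildCoeff (T B : ℝ) (c : ℝ → (d → ℤ) → ℂ) : Prop where
  /-- Coordinatewise continuity on `[0,T]`. -/
  continuousOn : ∀ k, ContinuousOn (fun t => c t k) (Icc 0 T)
  /-- Uniform bound of the finite `ℓ²` norms on `[0,T]`. -/
  l2F_le : ∀ t ∈ Icc 0 T, ∀ F : Finset (d → ℤ), l2F F (c t) ≤ B
  /-- Reality (conjugate symmetry) on `[0,T]`. -/
  symm : ∀ t ∈ Icc 0 T, ∀ k, c t (-k) = conj (c t k)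

omit [Fintype d] [DecidableEq d] [Nonempty d] in
/-- The bound of an admissible family is nonnegative (`T ≥ 0`). [cite: RobinsonRodrigoSadowski2016, Thm. 4.11] -/
theorem IsMildCoeff.nonneg (hc : IsMildCoeff T B c) (hT : 0 ≤ T) : 0 ≤ B :=
  (l2F_nonneg ∅ (c 0)).trans (hc.l2F_le 0 (left_mem_Icc.2 hT) ∅)

/-- **Synthesis of an admissible family**: a jointly measurable real field `w` on `(0,T) × T^d` with
`w(t) ∈ L²`, `∫ w(t)² ≤ B²` and `𝓕(w(t)) = c(t)` for EVERY `t ∈ [0,T]` (the parametrised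
Riesz–Fischer theorem `Torus.exists_realScalarField_forall_mFourierCoeff_eq` applied to the family
clamped to `[0,T]`; Parseval for the `L²` bound). [cite: RobinsonRodrigoSadowski2016, Thm. 4.11] -/
theorem IsMildCoeff.exists_field (hT : 0 ≤ T) (hc : IsMildCoeff T B c) :
    ∃ w : ℝ → UnitAddTorus d → ℝ, IsL2Field T (B ^ 2) w ∧
      ∀ t ∈ Icc 0 T, ∀ k, mFourierCoeff (fun x => (w t x : ℂ)) k = c t k := by
  set c' : ℝ → (d → ℤ) → ℂ := fun t => c (Set.projIcc 0 T hT t) with hc'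
  have hcl : ∀ t, (Set.projIcc 0 T hT t : ℝ) ∈ Icc 0 T := fun t => (Set.projIcc 0 T hT t).2
  have hcl_eq : ∀ t ∈ Icc 0 T, (Set.projIcc 0 T hT t : ℝ) = t := fun t ht => by
    rw [Set.projIcc_of_mem hT ht]
  have hB : 0 ≤ B := hc.nonneg hT
  have hcont : ∀ k, ContinuousOn (fun t => c' t k) (Ici 0) := fun k =>
    ((hc.continuousOn k).comp (continuous_subtype_val.comp continuous_projIcc).continuousOn
      fun t _ => hcl t)
  have hsum : ∀ t, 0 ≤ t → ∀ F : Finset (d → ℤ), ∑ k ∈ F, ‖c' t k‖ ^ 2 ≤ B ^ 2 := fun t _ F =>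
    (l2F_le_iff hB).1 (hc.l2F_le _ (hcl t) F)
  have hsymm : ∀ t, 0 ≤ t → ∀ k, c' t (-k) = conj (c' t k) := fun t _ k => hc.symm _ (hcl t) k
  obtain ⟨w, hwm, hw⟩ := exists_realScalarField_forall_mFourierCoeff_eq hcont hsum hsymm
  refine ⟨w, ⟨?_, fun t ht => (hw t ht.1).1, fun t ht => ?_⟩, fun t ht k => ?_⟩
  · exact aestronglyMeasurable_uncurry_of_stLift_prod
      (hwm.mono_set (Set.prod_mono Ioo_subset_Ioi_self subset_rfl))
  · have hP := hasSum_sq_norm_mFourierCoeff_ofReal (hw t ht.1).1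
    rw [← hP.tsum_eq]
    refine hP.summable.tsum_le_of_sum_le fun F => ?_
    calc ∑ k ∈ F, ‖mFourierCoeff (fun x => ((w t x : ℝ) : ℂ)) k‖ ^ 2 = ∑ k ∈ F, ‖c' t k‖ ^ 2 :=
          Finset.sum_congr rfl fun k _ => by rw [(hw t ht.1).2 k]
      _ ≤ B ^ 2 := hsum t ht.1 F
  · rw [(hw t ht.1).2 k, hc']
    dsimp only
    rw [hcl_eq t ht]

omit [DecidableEq d] [Nonempty d] in
/-- **Parseval for differences of synthesized fields**: if `𝓕(w(t)) = c(t)`, `𝓕(w'(t)) = c'(t)` on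
`[0,T]` and the finite `ℓ²` norms of `c - c'` are bounded by `δ`, then `w - w'` is a field with
`∫ (w - w')(t)² ≤ δ²`. [cite: Grafakos2014, Prop. 3.2.7 (3)] -/
theorem IsL2Field.sub_of_coeff {E E' : ℝ} {w w' : ℝ → UnitAddTorus d → ℝ} (hw : IsL2Field T E w)
    (hw' : IsL2Field T E' w') (hcw : ∀ t ∈ Icc 0 T, ∀ k, mFourierCoeff (fun x => (w t x : ℂ)) k = c t k)
    (hcw' : ∀ t ∈ Icc 0 T, ∀ k, mFourierCoeff (fun x => (w' t x : ℂ)) k = c' t k) {δ : ℝ} (hδ : 0 ≤ δ)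
    (h : ∀ t ∈ Icc 0 T, ∀ F : Finset (d → ℤ), l2F F (fun k => c t k - c' t k) ≤ δ) :
    IsL2Field T (δ ^ 2) (fun t x => w t x - w' t x) := by
  refine hw.sub hw' fun t ht => ?_
  have hm : MemLp (fun x => w t x - w' t x) 2 volume := (hw.memLp t ht).sub (hw'.memLp t ht)
  have hP := hasSum_sq_norm_mFourierCoeff_ofReal hm
  have hcoef : ∀ k, mFourierCoeff (fun x => ((w t x - w' t x : ℝ) : ℂ)) k = c t k - c' t k := by
    intro k
    have e : (fun x => ((w t x - w' t x : ℝ) : ℂ)) = (fun x => ((w t x : ℝ) : ℂ)) - fun x => ((w' t x : ℝ) : ℂ) := by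
      funext x; simp only [Pi.sub_apply, Complex.ofReal_sub]
    rw [e, mFourierCoeff_sub ((hw.memLp t ht).integrable one_le_two).ofReal
      ((hw'.memLp t ht).integrable one_le_two).ofReal, hcw t ht k, hcw' t ht k]
  rw [← hP.tsum_eq]
  refine hP.summable.tsum_le_of_sum_le fun F => ?_
  calc ∑ k ∈ F, ‖mFourierCoeff (fun x => ((w t x - w' t x : ℝ) : ℂ)) k‖ ^ 2
      = ∑ k ∈ F, ‖c t k - c' t k‖ ^ 2 := Finset.sum_congr rfl fun k _ => by rw [hcoef k]
    _ ≤ δ ^ 2 := (l2F_le_iff hδ).1 (h t ht F)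

end Coeff

/-! ## The Picard iteration and its fixed point -/

section Picard

/-- **The data of the Picard iteration**: the horizon `T > 0`, diffusivity `κ > 0`, coefficients
`aᵢ > 0`, a drift bounded by `U` on `(0,T) × T^d`, an `L²` datum `θ₀`, and a damping rate `λ > 0`
large enough that the contraction constant `q² = (∑ⱼaⱼ⁻¹)U²/(2κλ)` is at most `1/4`
(Pazy 1983, Ch. 6 §6.1, proof of Thm. 1.2: the Picard iteration for the mild equation). [cite: Pazy1983, Ch. 6 §6.1 Thm. 1.2 (proof: Picard iteration), p. 184] -/
structure MildData (d : Type*) [Fintype d] where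
  /-- the horizon -/
  T : ℝ
  /-- the diffusivity -/
  κ : ℝ
  /-- the damping rate -/
  lam : ℝ
  /-- the drift bound -/
  U : ℝ
  /-- the diffusion coefficients -/
  a : d → ℝ
  /-- the drift -/
  u : ℝ → UnitAddTorus d → EuclideanSpace ℝ d
  /-- the datum -/
  θ₀ : UnitAddTorus d → ℝ
  /-- `T > 0` -/
  hT : 0 < T
  /-- `κ > 0` -/
  hκ : 0 < κ
  /-- `λ > 0` -/
  hlam : 0 < lam
  /-- `aᵢ > 0` -/
  ha : ∀ i, 0 < a i
  /-- the drift is bounded by `U` a.e. on `(0,T) × T^d` -/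
  hu : DriftBound T u U
  /-- `θ₀ ∈ L²` -/
  hθ₀ : MemLp θ₀ 2 volume
  /-- the contraction constant is at most `1/2` -/
  hq : (∑ j, (a j)⁻¹) * U ^ 2 / (2 * κ * lam) ≤ 1 / 4

namespace MildData

variable [DecidableEq d] [Nonempty d] (P : MildData d)

/-- The `L²` norm of the datum, `A = (∫ θ₀²)^{1/2}`. [cite: Pazy1983, Ch. 6 §6.1 Thm. 1.2 (proof: Picard iteration), p. 184] -/
def A : ℝ := Real.sqrt (∫ x, P.θ₀ x ^ 2)

/-- The invariant bound of the iteration, `B = 2A`. [cite: Pazy1983, Ch. 6 §6.1 Thm. 1.2 (proof: Picard iteration), p. 184] -/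
def B : ℝ := 2 * P.A

omit [DecidableEq d] [Nonempty d] in
/-- `A ≥ 0`. [cite: Pazy1983, Ch. 6 §6.1 Thm. 1.2 (proof: Picard iteration), p. 184] -/
theorem A_nonneg : 0 ≤ P.A := Real.sqrt_nonneg _

omit [DecidableEq d] [Nonempty d] in
/-- `B ≥ 0`. [cite: Pazy1983, Ch. 6 §6.1 Thm. 1.2 (proof: Picard iteration), p. 184] -/
theorem B_nonneg : 0 ≤ P.B := mul_nonneg zero_le_two P.A_nonneg
end MildData

end Picard


end Torus

end Literature.Analysis.FluidPDE

end
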